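import Summits.BirchSwinnertonDyer.BirchSwinnertonDyer.Theorems.CMKolyvaginAtInertTwoCMKolyvaginConjectureAtInertTwoStrictDescentObstructionClass
import Summits.BirchSwinnertonDyer.BirchSwinnertonDyer.Theorems.CMKolyvaginAtInertTwoCMKolyvaginConjectureAtInertTwoFirstDescentAlongProducts
import Summits.BirchSwinnertonDyer.Rank1Residual.X11b.KolyvaginBottomPoint
import Literature.NumberTheory.EllipticCurves.HeegnerPointsKolyvaginPrimaryLeavesProofs
import Literature.NumberTheory.EllipticCurves.TwoTorsionOddDegreeBaseChangeProofs
import Literature.NumberTheory.EllipticCurves.SelmerProofs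
import Literature.NumberTheory.EllipticCurves.KummerMap
import HarnessLib

/-!
# Route `CMKolyvaginAtInertTwo`, crux `CMKolyvaginConjectureAtInertTwo` (stmt-BirchSwinnertonDyer-24648),
# stub `stub_positiveDepth` — ORDER OF THE STRICT-DESCENT OBSTRUCTION CLASS, ITS IMAGE IN `Ш(E/K)`,
# AND THE ONE-BIT SIGN CLASH AT `p = 2`

Seat `leafhand-bsd-cmkolyvaginatinert-6` g0 (cell `bsd-eis`); helper `--supports stmt-BirchSwinnertonDyer-24648`.
THEOREMS ONLY: no definition, no named fact, no `sorry`.  BSD is NOT proved by any of this; the stub and the crux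
stay OPEN.  Conditional inputs: Gross 1991 Prop. 3.7 (2) BY NAME (`GrossLMS1991.prop37_2_reductionCongruence_inert`,
item 28665) wherever the Selmer property of the class is used (as in the predecessor file), and — §3 only — the
`ε`-LINE hypothesis on `E(K)` (`τ x − ε x` torsion for every `x ∈ E(K)`, `ε = −w(E)`), which §4 derives from
`E(K) = ℤ g + torsion` plus a `K`-rational Heegner point of infinite order (Gross Prop. 5.3); on H₂ that is Kolyvagin's
rank theorem for the pair `(E, E^{(d_K)})`, an input of the route, not proved here.

Predecessor (`…StrictDescentObstructionClass`, hand -5): for a conductor-`1` datum with `2^{M₀} ∣ y_K`, `L ≥ M₀`, a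
Zhang–Kolyvagin prime `ℓ` at `2` of index `≥ L` and any datum `e` of conductor `ℓ`, the class `s_ℓ := 2^{L−M₀}·c_L(e)`
is `2^L`-Selmer, killed by `2^{M₀}`, of `τ`-sign `w(E)`, and `s_ℓ = 0 ⟺ 2^{M₀} ∣ P(ℓ)`.  This file adds:
§1 ORDER LADDER `2^j·s_ℓ = 0 ⟺ 2^{M₀−j} ∣ P(ℓ)`, so `addOrderOf s_ℓ = 2^{M₀−m}` when `2^m ∥ P(ℓ)`: **the exponent of
   the obstruction class IS the size of the descent at `ℓ`** (McCallum §5, `ord d`, at `p = 2`).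
§2 IMAGE IN Ш: the image `š_ℓ` of `s_ℓ` in `H¹(K, E)` lies in `Ш(E/K)`, is killed by `2^{M₀}` (Silverman X.4.2 (a), tree
   `map_torsionH1ToH1_selmerGroup_holds`), and `š = 0 ⟺ s` is a Kummer class `δ(x)`, `x ∈ E(K)` (tree `KummerMap`).
§3 ONE-BIT SIGN CLASH (the `p = 2` shadow of Gross's (5.1)): Kummer classes have sign `ε`, `s_ℓ` has sign `−ε`, a class
   with both signs is `2`-torsion; so **`š_ℓ = 0 ⟹ 2·s_ℓ = 0 ⟹ 2^{M₀−1} ∣ P(ℓ)`**.  Hence a descent of TWO OR MORE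
   bits at one Kolyvagin prime yields the explicit non-zero `š_ℓ ∈ Ш(E/K)[2^{M₀}]`
   (`sha_primaryComponent_two_ne_bot_of_not_dvd`), and **on a frame with `Ш(E/K)[2^∞] = ⊥` (regime of the child R0
   `CMHeegnerTwoPrimitiveOfTrivialShaTwo`) every Zhang–Kolyvagin prime of index `≥ L ≥ M₀` and every datum keep
   `2^{M₀−1} ∣ P(ℓ)`** — the first descent drops AT MOST ONE BIT there (at odd `p`: none);
   `exists_exactDepth_and_forall_pow_dvd_of_sha_eq_bot` says it in the stub's own currency (exact depth `M₀ ≥ 1` from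
   hand -5's `exists_exactDepth_pos`).
§4 `isOfFinAddOrder_map_sub_smul_of_generator`: the `ε`-line from `E(K) = ℤ g + torsion` (Gross Prop. 5.3 moved to `g`;
   adapted from the tree's `GenusExact.PlusDescent.conjAct_kummerMapTorsion_generator_eq`).
HONEST RESIDUAL.  Nothing here produces a prime with `s_ℓ ≠ 0` when `M₀ ≥ 1`: the file measures `s_ℓ` and reads it in
`Ш(E/K)` up to the lost bit.  Kolyvagin's converse at `2` ("`Ш` large ⟹ descent", McCallum Prop. 5.2 / Thm. 5.4 with the
`2^{m(ℓ)}`-th root of `c_L(ℓ)`) remains the research content of the stub.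
References: [McCallumLMS1991] §4 Cor. 4.5, §5 (class `d`, `ord d`, Prop. 5.2, Thm. 5.4); [GrossLMS1991] §5 (5.1),
Prop. 5.3; [SilvermanAEC2009] VIII.§2, Thm. X.4.2 (a); [Kolyvagin1991MathAnn] Thm. 2.2.
-/

set_option autoImplicit false
-- the Theorems namespace of this sub repeats the summit name by design (D-0017 nested layout)
set_option linter.dupNamespace false

noncomputable section

open scoped Classical

open Field NumberField IsDedekindDomain Function WeierstrassCurve
open Literature.NumberTheory.EllipticCurves
open Literature.NumberTheory.EllipticCurves.ModularForms
open Literature.NumberTheory.GaloisRepresentations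
open Literature.NumberTheory.GaloisCohomology
open Literature.NumberTheory.EllipticCurves.GrossLMS1991 (prop37_2_reductionCongruence_inert)

namespace Summit.BirchSwinnertonDyer.BirchSwinnertonDyer.Theorems.CMKolyvaginFirstDescentTwo

variable (W : WeierstrassCurve ℚ) [W.IsElliptic] [W.IsGloballyMinimal] [NeZero (W.conductorNorm ℤ)]
  {K : Type} [Field K] [NumberField K]

/-! ## §1 The order ladder of `s_ℓ = 2^{L−M₀}·c_L(ℓ)` -/

/-- **`2^j·s_ℓ = 0 ⟺ 2^{M₀−j} ∣ P(ℓ)`** for `j ≤ M₀ ≤ L` (frame: `ρ̄_{E,2}` onto, `K` imaginary quadratic with odd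
`d_K ≠ −3`, Heegner; `ℓ` Zhang–Kolyvagin at `2` of index `≥ L`; `e` any datum of conductor `ℓ`).  The predecessor's
`obstructionClass_eq_zero_iff` at depth `M₀ − j`, since `2^j·2^{L−M₀} = 2^{L−(M₀−j)}`.
[cite: McCallumLMS1991, §4 Cor. 4.5, §5 (ord d)] -/
theorem pow_zsmul_obstructionClass_eq_zero_iff (hρ2 : W.HasSurjectiveModNGaloisRep 2)
    (hK : IsImaginaryQuadratic K) (hodd : Odd (NumberField.discr K)) (h3 : NumberField.discr K ≠ -3)
    (hHe : SatisfiesHeegnerHypothesis (W.conductorNorm ℤ) K)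
    (Dt : ModularParametrizationData W (W.conductorNorm ℤ)) (β : ℤ) (ι : K →+* ℂ)
    (d₁ : KolyvaginHeegnerData Dt β ι 1) {M₀ L j : ℕ} (hj : j ≤ M₀) (hML : M₀ ≤ L)
    {ℓ : ℕ} (hKol : Zhang2014.IsKolyvaginPrime (W.conductorNorm ℤ) W K 2 ℓ)
    (hidx : L ≤ Zhang2014.kolyvaginIndex W 2 ℓ) (e : KolyvaginHeegnerData Dt β ι ℓ) :
    ((2 ^ j : ℕ) : ℤ) • (((2 ^ (L - M₀) : ℕ) : ℤ) • e.kolyvaginClass Nat.prime_two L) = 0 ↔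
      ∃ Q : (W.baseChange (ringClassField K ι ℓ)).toAffine.Point,
        ((2 ^ (M₀ - j) : ℕ) : ℤ) • Q = e.derivedPoint := by
  have h : ((2 ^ j : ℕ) : ℤ) • (((2 ^ (L - M₀) : ℕ) : ℤ) • e.kolyvaginClass Nat.prime_two L) =
      ((2 ^ (L - (M₀ - j)) : ℕ) : ℤ) • e.kolyvaginClass Nat.prime_two L := by
    rw [smul_smul, ← Nat.cast_mul, ← pow_add, show j + (L - M₀) = L - (M₀ - j) by omega]
  rw [h]
  exact obstructionClass_eq_zero_iff W hρ2 hK hodd h3 hHe Dt β ι d₁ (by omega) hKol hidx e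

/-- **`addOrderOf s_ℓ = 2^{M₀ − m}` when `2^m ∥ P(ℓ)`, `m ≤ M₀ ≤ L`**: the exponent of the obstruction class is the
size `M₀ − m(ℓ)` of the descent at `ℓ` (McCallum's `ord d`, §5, at `p = 2`). [cite: McCallumLMS1991, §5 (the class d)] -/
theorem addOrderOf_obstructionClass (hρ2 : W.HasSurjectiveModNGaloisRep 2)
    (hK : IsImaginaryQuadratic K) (hodd : Odd (NumberField.discr K)) (h3 : NumberField.discr K ≠ -3)
    (hHe : SatisfiesHeegnerHypothesis (W.conductorNorm ℤ) K)
    (Dt : ModularParametrizationData W (W.conductorNorm ℤ)) (β : ℤ) (ι : K →+* ℂ)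
    (d₁ : KolyvaginHeegnerData Dt β ι 1) {M₀ L m : ℕ} (hm : m ≤ M₀) (hML : M₀ ≤ L)
    {ℓ : ℕ} (hKol : Zhang2014.IsKolyvaginPrime (W.conductorNorm ℤ) W K 2 ℓ)
    (hidx : L ≤ Zhang2014.kolyvaginIndex W 2 ℓ) (e : KolyvaginHeegnerData Dt β ι ℓ)
    (hdvd : ∃ Q : (W.baseChange (ringClassField K ι ℓ)).toAffine.Point, ((2 ^ m : ℕ) : ℤ) • Q = e.derivedPoint)
    (hndvd : ¬ ∃ Q : (W.baseChange (ringClassField K ι ℓ)).toAffine.Point,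
      ((2 ^ (m + 1) : ℕ) : ℤ) • Q = e.derivedPoint) :
    addOrderOf (((2 ^ (L - M₀) : ℕ) : ℤ) • e.kolyvaginClass Nat.prime_two L) = 2 ^ (M₀ - m) := by
  haveI : Fact (Nat.Prime 2) := ⟨Nat.prime_two⟩
  set s := ((2 ^ (L - M₀) : ℕ) : ℤ) • e.kolyvaginClass Nat.prime_two L with hs
  obtain ⟨k, hk⟩ : ∃ k, M₀ - m = k := ⟨_, rfl⟩
  rw [hk]
  cases k with
  | zero => -- `m = M₀`: `s = 0`
    obtain rfl : m = M₀ := by omega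
    have h := (pow_zsmul_obstructionClass_eq_zero_iff W hρ2 hK hodd h3 hHe Dt β ι d₁ (Nat.zero_le m) hML hKol
      hidx e).mpr (by rw [Nat.sub_zero]; exact hdvd)
    rw [pow_zero, Nat.cast_one, one_smul, ← hs] at h
    rw [h, pow_zero, addOrderOf_zero]
  | succ n =>
    have hn1 : n + 1 ≤ M₀ := by omega
    refine addOrderOf_eq_prime_pow (fun h ↦ hndvd ?_) ?_
    · -- `2^n • s = 0 ⟹ 2^{M₀−n} = 2^{m+1} ∣ P(ℓ)`
      rw [← natCast_zsmul, hs] at h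
      have h' := (pow_zsmul_obstructionClass_eq_zero_iff W hρ2 hK hodd h3 hHe Dt β ι d₁ (by omega : n ≤ M₀) hML
        hKol hidx e).mp h
      have hmn : M₀ - n = m + 1 := by omega
      rwa [hmn] at h'
    · -- `2^m ∣ P(ℓ) ⟹ 2^{n+1} • s = 0`
      rw [← natCast_zsmul, hs]
      refine (pow_zsmul_obstructionClass_eq_zero_iff W hρ2 hK hodd h3 hHe Dt β ι d₁ hn1 hML hKol hidx e).mpr ?_
      have hmn : M₀ - (n + 1) = m := by omega
      rw [hmn]
      exact hdvd

/-! ## §2 The image `š_ℓ` of `s_ℓ` in `Ш(E/K)` -/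

/-- **`š_ℓ ∈ Ш(E/K)` and `2^{M₀}·š_ℓ = 0`**, where `š_ℓ` is the image of `s_ℓ` under `H¹(K, E[2^L]) → H¹(K, E)`:
the predecessor's `obstructionClass_mem_selmerGroup` (needs the odd Tamagawa product and Gross Prop. 3.7 (2) by name)
and Silverman X.4.2 (a) (`Sel^{(n)} ↠ Ш[n]`, the tree's `map_torsionH1ToH1_selmerGroup_holds`).
[cite: SilvermanAEC2009, Thm X.4.2 (a)] [cite: McCallumLMS1991, §5 (the class d)] -/
theorem torsionH1ToH1_obstructionClass_mem_sha (hρ2 : W.HasSurjectiveModNGaloisRep 2) (hT : Odd W.tamagawaProduct)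
    (hK : IsImaginaryQuadratic K) (hodd : Odd (NumberField.discr K)) (h3 : NumberField.discr K ≠ -3)
    (hHe : SatisfiesHeegnerHypothesis (W.conductorNorm ℤ) K)
    (h37 : prop37_2_reductionCongruence_inert (W.conductorNorm ℤ) W K)
    (Dt : ModularParametrizationData W (W.conductorNorm ℤ)) (β : ℤ) (ι : K →+* ℂ)
    (d₁ : KolyvaginHeegnerData Dt β ι 1) {M₀ L : ℕ} (hML : M₀ ≤ L)
    (hdiv : ∃ Q : (W.baseChange (ringClassField K ι 1)).toAffine.Point,
      ((2 ^ M₀ : ℕ) : ℤ) • Q = d₁.derivedPoint)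
    {ℓ : ℕ} (hKol : Zhang2014.IsKolyvaginPrime (W.conductorNorm ℤ) W K 2 ℓ)
    (hidx : L ≤ Zhang2014.kolyvaginIndex W 2 ℓ) (e : KolyvaginHeegnerData Dt β ι ℓ) :
    torsionH1ToH1 (W.baseChange K) ((2 ^ L : ℕ) : ℤ)
        (((2 ^ (L - M₀) : ℕ) : ℤ) • e.kolyvaginClass Nat.prime_two L) ∈ (W.baseChange K).sha ∧
      ((2 ^ M₀ : ℕ) : ℤ) • torsionH1ToH1 (W.baseChange K) ((2 ^ L : ℕ) : ℤ)
        (((2 ^ (L - M₀) : ℕ) : ℤ) • e.kolyvaginClass Nat.prime_two L) = 0 := by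
  obtain ⟨hSel, -, hkill⟩ :=
    obstructionClass_mem_selmerGroup W hρ2 hT hK hodd h3 hHe h37 Dt β ι d₁ hML hdiv hKol hidx e
  have hn : ((2 ^ L : ℕ) : ℤ) ≠ 0 := by positivity
  have hmap := WeierstrassCurve.map_torsionH1ToH1_selmerGroup_holds (W.baseChange K) hn
  have hmem : torsionH1ToH1 (W.baseChange K) ((2 ^ L : ℕ) : ℤ)
      (((2 ^ (L - M₀) : ℕ) : ℤ) • e.kolyvaginClass Nat.prime_two L) ∈
      ((W.baseChange K).selmerGroup ((2 ^ L : ℕ) : ℤ)).map (torsionH1ToH1 (W.baseChange K) ((2 ^ L : ℕ) : ℤ)) :=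
    AddSubgroup.mem_map_of_mem _ hSel
  rw [hmap] at hmem
  exact ⟨hmem.1, by rw [← map_zsmul, hkill, map_zero]⟩

/-! ## §3 The one-bit sign clash at `p = 2` -/

omit [W.IsElliptic] [W.IsGloballyMinimal] [NeZero (W.conductorNorm ℤ)] in
/-- If `ε = ±1` and `ε • y = (−ε) • y` then `2 • y = 0` (a vector in two opposite eigenlines of an involution is
`2`-torsion). [folklore] -/
theorem two_zsmul_eq_zero_of_smul_eq_neg_smul {A : Type*} [AddCommGroup A] {ε : ℤ} (hε : ε = 1 ∨ ε = -1)
    {y : A} (h : ε • y = (-ε) • y) : (2 : ℤ) • y = 0 := by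
  rcases hε with rfl | rfl
  · rwa [one_smul, neg_smul, one_smul, eq_neg_iff_add_eq_zero, ← two_zsmul] at h
  · rwa [neg_neg, neg_smul, one_smul, neg_eq_iff_add_eq_zero, ← two_zsmul] at h

omit [W.IsElliptic] [W.IsGloballyMinimal] [NeZero (W.conductorNorm ℤ)] in
/-- **Kummer classes of `E(K)` are `ε`-eigenclasses, granted the `ε`-line** (`τ x − ε x` torsion for all `x ∈ E(K)`,
`E(K)[2] = 0`, level `2^L`): `τ_* δ(x) = δ(τ x) = δ(ε x + t) = ε δ(x)`, the torsion point `t` being of odd order, hence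
`2^L`-divisible, hence killed by `δ` (the tree's `conjAct_kummerMapTorsion`, `exists_pow_smul_eq_of_isOfFinAddOrder`).
[cite: GrossLMS1991, §5 (5.1), Prop. 5.3] [cite: SilvermanAEC2009, VIII.§2] -/
theorem conjAct_kummerMapTorsion_eq_smul_of_line (τ : K ≃ₐ[ℚ] K) {L : ℕ}
    (hdivK : ∀ P : geomPoints (W.baseChange K), ∃ Q : geomPoints (W.baseChange K), ((2 ^ L : ℕ) : ℤ) • Q = P)
    (h2 : ∀ T : (W.baseChange K).toAffine.Point, (2 : ℤ) • T = 0 → T = 0) {ε : ℤ}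
    (hline : ∀ x : (W.baseChange K).toAffine.Point,
      IsOfFinAddOrder (Affine.Point.map (W' := W) (τ : K →ₐ[ℚ] K) x - ε • x))
    (x : (W.baseChange K).toAffine.Point) :
    conjAct W τ ((2 ^ L : ℕ) : ℤ) (kummerMapTorsion (W.baseChange K) ((2 ^ L : ℕ) : ℤ) hdivK x) =
      ε • kummerMapTorsion (W.baseChange K) ((2 ^ L : ℕ) : ℤ) hdivK x := by
  set t : (W.baseChange K).toAffine.Point := Affine.Point.map (W' := W) (τ : K →ₐ[ℚ] K) x - ε • x with ht
  have h2' : ∀ a : (W.baseChange K).toAffine.Point, 2 • a = 0 → a = 0 := fun a ha ↦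
    h2 a (by rw [← natCast_zsmul] at ha; exact_mod_cast ha)
  obtain ⟨u, hu⟩ := exists_pow_smul_eq_of_isOfFinAddOrder Nat.prime_two h2' (hline x) L
  have hδt : kummerMapTorsion (W.baseChange K) ((2 ^ L : ℕ) : ℤ) hdivK t = 0 := by
    rw [ht, ← hu, ← Nat.cast_pow, map_zsmul]
    exact zsmul_discreteH1_torsion _ _
  have hx : Affine.Point.map (W' := W) (τ : K →ₐ[ℚ] K) x = ε • x + t := by rw [ht]; abel
  rw [conjAct_kummerMapTorsion, hx, map_add, map_zsmul, hδt, add_zero]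

omit [W.IsElliptic] [W.IsGloballyMinimal] [NeZero (W.conductorNorm ℤ)] in
/-- **The sign clash**: if all Kummer classes have sign `ε = ±1` and `s` has sign `−ε`, then `š = 0 ⟹ 2·s = 0`
(`š = 0 ⟺ s = δ(x)`, `x ∈ E(K)`, by the tree's Kummer sequence `mem_range_kummerMapTorsion_of_torsionH1ToH1_eq_zero`):
at `p = 2` a `(−ε)`-eigenclass coming from `E(K)` is `2`-torsion (one bit), where at odd `p` it would vanish.
[cite: GrossLMS1991, §5 (5.1)] [cite: SilvermanAEC2009, VIII.§2 (Kummer sequence)] -/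
theorem two_zsmul_eq_zero_of_torsionH1ToH1_eq_zero_of_signs (τ : K ≃ₐ[ℚ] K) {n : ℤ}
    (hdivK : ∀ P : geomPoints (W.baseChange K), ∃ Q : geomPoints (W.baseChange K), n • Q = P)
    {ε : ℤ} (hε : ε = 1 ∨ ε = -1)
    (hkum : ∀ x : (W.baseChange K).toAffine.Point,
      conjAct W τ n (kummerMapTorsion (W.baseChange K) n hdivK x) = ε • kummerMapTorsion (W.baseChange K) n hdivK x)
    {s : galH1Torsion (W.baseChange K) n} (hs : conjAct W τ n s = (-ε) • s)
    (hker : torsionH1ToH1 (W.baseChange K) n s = 0) : (2 : ℤ) • s = 0 := by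
  obtain ⟨x, rfl⟩ := mem_range_kummerMapTorsion_of_torsionH1ToH1_eq_zero (W.baseChange K) n hdivK s hker
  exact two_zsmul_eq_zero_of_smul_eq_neg_smul hε (by rw [← hkum x, hs])

/-- **`š_ℓ = 0 ⟹ 2·s_ℓ = 0`** on the frame (`ρ̄_{E,2}` onto, `K` imaginary quadratic with odd `d_K ≠ −3`, Heegner,
`τ ≠ 1`; `ℓ` Zhang–Kolyvagin at `2` of index `≥ L ≥ 1`; `e` any datum), GRANTED the `ε`-line for `E(K)` with
`ε = −w(E)`: the class `s_ℓ` has `τ`-sign `w(E) = −ε` (predecessor's `conjAct_obstructionClass`, Gross Prop. 5.3),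
Kummer classes have sign `ε` (`conjAct_kummerMapTorsion_eq_smul_of_line`; `E(K)[2] = 0` by the tree's
Dokchitser–Dokchitser lemma for `ρ̄_{E,2}` onto over an imaginary quadratic field).
[cite: GrossLMS1991, §5 (5.1), Prop. 5.3] [cite: McCallumLMS1991, §5 (p. 303)] -/
theorem two_zsmul_obstructionClass_eq_zero_of_torsionH1ToH1_eq_zero (hρ2 : W.HasSurjectiveModNGaloisRep 2)
    (hK : IsImaginaryQuadratic K) (hodd : Odd (NumberField.discr K)) (h3 : NumberField.discr K ≠ -3)
    (hHe : SatisfiesHeegnerHypothesis (W.conductorNorm ℤ) K) (τ : K ≃ₐ[ℚ] K) (hτ : τ ≠ 1)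
    (hline : ∀ x : (W.baseChange K).toAffine.Point,
      IsOfFinAddOrder (Affine.Point.map (W' := W) (τ : K →ₐ[ℚ] K) x - (-W.rootNumber) • x))
    (Dt : ModularParametrizationData W (W.conductorNorm ℤ)) (β : ℤ) (ι : K →+* ℂ) {M₀ L : ℕ} (hL : 1 ≤ L)
    {ℓ : ℕ} (hKol : Zhang2014.IsKolyvaginPrime (W.conductorNorm ℤ) W K 2 ℓ)
    (hidx : L ≤ Zhang2014.kolyvaginIndex W 2 ℓ) (e : KolyvaginHeegnerData Dt β ι ℓ)
    (hker : torsionH1ToH1 (W.baseChange K) ((2 ^ L : ℕ) : ℤ)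
      (((2 ^ (L - M₀) : ℕ) : ℤ) • e.kolyvaginClass Nat.prime_two L) = 0) :
    (2 : ℤ) • (((2 ^ (L - M₀) : ℕ) : ℤ) • e.kolyvaginClass Nat.prime_two L) = 0 := by
  have hn : ((2 ^ L : ℕ) : ℤ) ≠ 0 := by positivity
  have hdivK : ∀ P : geomPoints (W.baseChange K), ∃ Q : geomPoints (W.baseChange K), ((2 ^ L : ℕ) : ℤ) • Q = P :=
    zsmul_geomPoints_surjective_of_charZero (W.baseChange K) hn
  have h2 : ∀ T : (W.baseChange K).toAffine.Point, (2 : ℤ) • T = 0 → T = 0 := fun T hT ↦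
    forall_two_nsmul_baseChange_of_hasSurjectiveModNGaloisRep_two_of_isImaginaryQuadratic W hρ2 K hK T
      (by rw [← natCast_zsmul]; exact_mod_cast hT)
  obtain ⟨hsgn, hτs⟩ := conjAct_obstructionClass W hρ2 hK hodd h3 hHe τ hτ Dt β ι (M₀ := M₀) hL hKol hidx e
  have hw : -W.rootNumber * (-1) ^ 1 = -(-W.rootNumber) := by ring
  rw [hw] at hsgn hτs
  have hε : -W.rootNumber = 1 ∨ -W.rootNumber = -1 := by rcases hsgn with h | h <;> [right; left] <;> linarith
  exact two_zsmul_eq_zero_of_torsionH1ToH1_eq_zero_of_signs W τ hdivK hε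
    (conjAct_kummerMapTorsion_eq_smul_of_line W τ hdivK h2 hline) hτs hker

/-- **A DESCENT OF TWO OR MORE BITS AT ONE KOLYVAGIN PRIME PRODUCES `Ш(E/K)[2] ≠ 0`.**  Frame: `W` globally minimal with
`ρ̄_{E,2}` onto and ODD Tamagawa product; `K` imaginary quadratic, odd `d_K ≠ −3`, Heegner, `τ ≠ 1`; Gross 1991
Prop. 3.7 (2) at `(W, K)` by name; the `ε`-line for `E(K)` (`ε = −w(E)`); a conductor-`1` datum with `2^{M₀} ∣ y_K`,
`1 ≤ M₀ ≤ L`; `ℓ` a Zhang–Kolyvagin prime at `2` of index `≥ L`; `e` ANY datum of conductor `ℓ` with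
**`2^{M₀−1} ∤ P(ℓ)`**.  Then the image `š_ℓ` of `s_ℓ = 2^{L−M₀}·c_L(e)` in `H¹(K, E)` is a NON-ZERO element of `Ш(E/K)`
killed by `2^{M₀}`; in particular `Ш(E/K)[2^∞] ≠ ⊥` (McCallum §5: strict descent produces `Ш`; at `2` one bit is lost).
[cite: McCallumLMS1991, §5 (the class d, Prop. 5.2)] [cite: GrossLMS1991, §5 (5.1), Prop. 5.3] -/
theorem sha_primaryComponent_two_ne_bot_of_not_dvd (hρ2 : W.HasSurjectiveModNGaloisRep 2)
    (hT : Odd W.tamagawaProduct)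
    (hK : IsImaginaryQuadratic K) (hodd : Odd (NumberField.discr K)) (h3 : NumberField.discr K ≠ -3)
    (hHe : SatisfiesHeegnerHypothesis (W.conductorNorm ℤ) K)
    (h37 : prop37_2_reductionCongruence_inert (W.conductorNorm ℤ) W K) (τ : K ≃ₐ[ℚ] K) (hτ : τ ≠ 1)
    (hline : ∀ x : (W.baseChange K).toAffine.Point,
      IsOfFinAddOrder (Affine.Point.map (W' := W) (τ : K →ₐ[ℚ] K) x - (-W.rootNumber) • x))
    (Dt : ModularParametrizationData W (W.conductorNorm ℤ)) (β : ℤ) (ι : K →+* ℂ)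
    (d₁ : KolyvaginHeegnerData Dt β ι 1) {M₀ L : ℕ} (hM₀ : 1 ≤ M₀) (hML : M₀ ≤ L)
    (hdiv : ∃ Q : (W.baseChange (ringClassField K ι 1)).toAffine.Point,
      ((2 ^ M₀ : ℕ) : ℤ) • Q = d₁.derivedPoint)
    {ℓ : ℕ} (hKol : Zhang2014.IsKolyvaginPrime (W.conductorNorm ℤ) W K 2 ℓ)
    (hidx : L ≤ Zhang2014.kolyvaginIndex W 2 ℓ) (e : KolyvaginHeegnerData Dt β ι ℓ)
    (hnd : ¬ ∃ Q : (W.baseChange (ringClassField K ι ℓ)).toAffine.Point,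
      ((2 ^ (M₀ - 1) : ℕ) : ℤ) • Q = e.derivedPoint) :
    torsionH1ToH1 (W.baseChange K) ((2 ^ L : ℕ) : ℤ)
        (((2 ^ (L - M₀) : ℕ) : ℤ) • e.kolyvaginClass Nat.prime_two L) ≠ 0 ∧
      torsionH1ToH1 (W.baseChange K) ((2 ^ L : ℕ) : ℤ)
        (((2 ^ (L - M₀) : ℕ) : ℤ) • e.kolyvaginClass Nat.prime_two L) ∈ (W.baseChange K).sha ∧
      ((2 ^ M₀ : ℕ) : ℤ) • torsionH1ToH1 (W.baseChange K) ((2 ^ L : ℕ) : ℤ)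
        (((2 ^ (L - M₀) : ℕ) : ℤ) • e.kolyvaginClass Nat.prime_two L) = 0 ∧
      AddCommGroup.primaryComponent (W.baseChange K).sha 2 ≠ ⊥ := by
  have hL : 1 ≤ L := le_trans hM₀ hML
  obtain ⟨hsha, hkill⟩ :=
    torsionH1ToH1_obstructionClass_mem_sha W hρ2 hT hK hodd h3 hHe h37 Dt β ι d₁ hML hdiv hKol hidx e
  -- `2 • s_ℓ ≠ 0` since `2^{M₀−1} ∤ P(ℓ)`
  have h2s : (2 : ℤ) • (((2 ^ (L - M₀) : ℕ) : ℤ) • e.kolyvaginClass Nat.prime_two L) ≠ 0 := by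
    intro h
    refine hnd ((pow_zsmul_obstructionClass_eq_zero_iff W hρ2 hK hodd h3 hHe Dt β ι d₁ hM₀ hML hKol hidx e).mp ?_)
    rwa [pow_one, Nat.cast_ofNat]
  have hne : torsionH1ToH1 (W.baseChange K) ((2 ^ L : ℕ) : ℤ)
      (((2 ^ (L - M₀) : ℕ) : ℤ) • e.kolyvaginClass Nat.prime_two L) ≠ 0 := fun hker ↦
    h2s (two_zsmul_obstructionClass_eq_zero_of_torsionH1ToH1_eq_zero W hρ2 hK hodd h3 hHe τ hτ hline Dt β ι hL
      hKol hidx e hker)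
  have hmem : (⟨_, hsha⟩ : (W.baseChange K).sha) ∈ AddCommGroup.primaryComponent (W.baseChange K).sha 2 := by
    rw [AddCommGroup.mem_primaryComponent]
    refine ⟨M₀, Subtype.ext ?_⟩
    rw [AddSubgroup.coe_nsmul, AddSubgroup.coe_zero, ← natCast_zsmul]
    exact hkill
  refine ⟨hne, hsha, hkill, fun hbot ↦ hne ?_⟩
  rw [hbot, AddSubgroup.mem_bot] at hmem
  exact congrArg Subtype.val hmem

/-- **ON A TRIVIAL-`Ш` FRAME THE FIRST DESCENT DROPS AT MOST ONE BIT** (the regime of the child R0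
`CMHeegnerTwoPrimitiveOfTrivialShaTwo`): same frame and `ε`-line as above, `Ш(E/K)[2^∞] = ⊥`, a conductor-`1` datum
with `2^{M₀} ∣ y_K`, `1 ≤ M₀ ≤ L`; then for EVERY Zhang–Kolyvagin prime `ℓ` at `2` of index `≥ L` and EVERY datum `e`
of conductor `ℓ`: **`2^{M₀−1} ∣ P(ℓ)` in `E(K[ℓ])`** (at odd `p`, trivial `Ш` would force `m(ℓ) = m(1)`; at `2`
one bit may be lost).  Contrapositive of `sha_primaryComponent_two_ne_bot_of_not_dvd`.
[cite: McCallumLMS1991, §5 (Prop. 5.2, Thm. 5.4)] [cite: GrossLMS1991, §5 (5.1), Prop. 5.3] -/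
theorem pow_dvd_derivedPoint_of_sha_primaryComponent_eq_bot (hρ2 : W.HasSurjectiveModNGaloisRep 2)
    (hT : Odd W.tamagawaProduct)
    (hK : IsImaginaryQuadratic K) (hodd : Odd (NumberField.discr K)) (h3 : NumberField.discr K ≠ -3)
    (hHe : SatisfiesHeegnerHypothesis (W.conductorNorm ℤ) K)
    (h37 : prop37_2_reductionCongruence_inert (W.conductorNorm ℤ) W K) (τ : K ≃ₐ[ℚ] K) (hτ : τ ≠ 1)
    (hline : ∀ x : (W.baseChange K).toAffine.Point,
      IsOfFinAddOrder (Affine.Point.map (W' := W) (τ : K →ₐ[ℚ] K) x - (-W.rootNumber) • x))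
    (hSha : AddCommGroup.primaryComponent (W.baseChange K).sha 2 = ⊥)
    (Dt : ModularParametrizationData W (W.conductorNorm ℤ)) (β : ℤ) (ι : K →+* ℂ)
    (d₁ : KolyvaginHeegnerData Dt β ι 1) {M₀ L : ℕ} (hM₀ : 1 ≤ M₀) (hML : M₀ ≤ L)
    (hdiv : ∃ Q : (W.baseChange (ringClassField K ι 1)).toAffine.Point,
      ((2 ^ M₀ : ℕ) : ℤ) • Q = d₁.derivedPoint)
    {ℓ : ℕ} (hKol : Zhang2014.IsKolyvaginPrime (W.conductorNorm ℤ) W K 2 ℓ)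
    (hidx : L ≤ Zhang2014.kolyvaginIndex W 2 ℓ) (e : KolyvaginHeegnerData Dt β ι ℓ) :
    ∃ Q : (W.baseChange (ringClassField K ι ℓ)).toAffine.Point, ((2 ^ (M₀ - 1) : ℕ) : ℤ) • Q = e.derivedPoint := by
  by_contra hnd
  exact (sha_primaryComponent_two_ne_bot_of_not_dvd W hρ2 hT hK hodd h3 hHe h37 τ hτ hline Dt β ι d₁ hM₀ hML hdiv
    hKol hidx e hnd).2.2.2 hSha

/-- **The same in the stub's own currency.**  On the frame of `stub_positiveDepth` (`y_K = P(1)` of infinite order and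
`2 ∣ y_K` in `E(K[1])`), with the `ε`-line and `Ш(E/K)[2^∞] = ⊥`: there is an EXACT depth `M₀ ≥ 1`
(`2^{M₀} ∥ y_K`, hand -5's `exists_exactDepth_pos`, Mordell–Weil over `K[1]`) such that for every `L ≥ M₀`, every
Zhang–Kolyvagin prime `ℓ` at `2` of index `≥ L` and every datum `e` of conductor `ℓ`, `2^{M₀−1} ∣ P_e(ℓ)`.
[cite: McCallumLMS1991, §5 (Prop. 5.2, Thm. 5.4)] [cite: SilvermanAEC2009, Thm. VIII.6.7] -/
theorem exists_exactDepth_and_forall_pow_dvd_of_sha_eq_bot (hρ2 : W.HasSurjectiveModNGaloisRep 2)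
    (hT : Odd W.tamagawaProduct)
    (hK : IsImaginaryQuadratic K) (hodd : Odd (NumberField.discr K)) (h3 : NumberField.discr K ≠ -3)
    (hHe : SatisfiesHeegnerHypothesis (W.conductorNorm ℤ) K)
    (h37 : prop37_2_reductionCongruence_inert (W.conductorNorm ℤ) W K) (τ : K ≃ₐ[ℚ] K) (hτ : τ ≠ 1)
    (hline : ∀ x : (W.baseChange K).toAffine.Point,
      IsOfFinAddOrder (Affine.Point.map (W' := W) (τ : K →ₐ[ℚ] K) x - (-W.rootNumber) • x))
    (hSha : AddCommGroup.primaryComponent (W.baseChange K).sha 2 = ⊥)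
    (Dt : ModularParametrizationData W (W.conductorNorm ℤ)) (β : ℤ) (ι : K →+* ℂ)
    (d₁ : KolyvaginHeegnerData Dt β ι 1) (hy : ¬ IsOfFinAddOrder d₁.derivedPoint)
    (hpos : ∃ Q : (W.baseChange (ringClassField K ι 1)).toAffine.Point, (2 : ℤ) • Q = d₁.derivedPoint) :
    ∃ M₀ : ℕ, 1 ≤ M₀ ∧
      (∃ Q : (W.baseChange (ringClassField K ι 1)).toAffine.Point, ((2 ^ M₀ : ℕ) : ℤ) • Q = d₁.derivedPoint) ∧
      (¬ ∃ Q : (W.baseChange (ringClassField K ι 1)).toAffine.Point,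
        ((2 ^ (M₀ + 1) : ℕ) : ℤ) • Q = d₁.derivedPoint) ∧
      ∀ (L : ℕ), M₀ ≤ L → ∀ (ℓ : ℕ), Zhang2014.IsKolyvaginPrime (W.conductorNorm ℤ) W K 2 ℓ →
        L ≤ Zhang2014.kolyvaginIndex W 2 ℓ → ∀ e : KolyvaginHeegnerData Dt β ι ℓ,
          ∃ Q : (W.baseChange (ringClassField K ι ℓ)).toAffine.Point,
            ((2 ^ (M₀ - 1) : ℕ) : ℤ) • Q = e.derivedPoint := by
  obtain ⟨M₀, hM₀, hdiv, hndiv⟩ := exists_exactDepth_pos W hK Dt β ι d₁ hy hpos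
  exact ⟨M₀, hM₀, hdiv, hndiv, fun L hML ℓ hKol hidx e ↦
    pow_dvd_derivedPoint_of_sha_primaryComponent_eq_bot W hρ2 hT hK hodd h3 hHe h37 τ hτ hline hSha Dt β ι d₁ hM₀
      hML hdiv hKol hidx e⟩

/-! ## §4 The `ε`-line from a generator of `E(K)` modulo torsion (Gross Prop. 5.3) -/

/-- **The `ε`-line for `E(K) = ℤ g + torsion`** (`K` imaginary quadratic and Heegner for `N_W`, `τ ≠ 1`; a `K`-rational
Heegner point `Ph` of infinite order; `g` with every `x ∈ E(K)` congruent to a multiple of `g` modulo torsion): for every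
`x ∈ E(K)`, `τ x − (−w(E)) x` is torsion.  Gross Prop. 5.3 (`τ Ph + w(E) Ph` torsion, the tree's
`X11b.KolyvaginBottom.isOfFinAddOrder_map_sub_neg_rootNumber_smul`) moved from `Ph = k₀ g + t₀` (`k₀ ≠ 0`) to `g`,
then to `x = c g + t`.  [cite: GrossLMS1991, §5 Prop. 5.3] -/
theorem isOfFinAddOrder_map_sub_smul_of_generator (hK : IsImaginaryQuadratic K)
    (hHe : SatisfiesHeegnerHypothesis (W.conductorNorm ℤ) K) (τ : K ≃ₐ[ℚ] K) (hτ : τ ≠ 1)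
    {Ph : (W.baseChange K).toAffine.Point} (hPh : IsHeegnerPoint (W.conductorNorm ℤ) W K Ph)
    (hnt : ¬ IsOfFinAddOrder Ph) (g : (W.baseChange K).toAffine.Point)
    (hgT : ∀ x : (W.baseChange K).toAffine.Point, ∃ c : ℤ, IsOfFinAddOrder (x - c • g))
    (x : (W.baseChange K).toAffine.Point) :
    IsOfFinAddOrder (Affine.Point.map (W' := W) (τ : K →ₐ[ℚ] K) x - (-W.rootNumber) • x) := by
  -- adapted from Theorems/GenusKolyvaginAtTwoPowDvdShaCardAtTwoRTOrthogonalCapstoneFrame (`…_generator_eq`)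
  set τm := Affine.Point.map (W' := W) (τ : K →ₐ[ℚ] K) with hτm
  -- Gross: `τ Ph − ε Ph` is torsion, `ε = −w(E)`
  have hgross := Rank1Residual.X11b.KolyvaginBottom.isOfFinAddOrder_map_sub_neg_rootNumber_smul
    (W := W) hK hHe hPh τ hτ
  -- `Ph = k₀ g + t₀` with `k₀ ≠ 0`
  obtain ⟨k₀, hk₀⟩ := hgT Ph
  have hk₀ne : k₀ ≠ 0 := by
    rintro rfl
    rw [zero_smul, sub_zero] at hk₀
    exact hnt hk₀
  -- differences of torsion elements are torsion
  have hsub : ∀ {a b : (W.baseChange K).toAffine.Point}, IsOfFinAddOrder a → IsOfFinAddOrder b →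
      IsOfFinAddOrder (a - b) := fun ha hb ↦ by
    rw [sub_eq_add_neg]
    exact ha.add hb.neg
  -- `k₀ • (τ g − ε g) = (τ Ph − ε Ph) − (τ − ε)(Ph − k₀ g)` is torsion
  have ht₀ : IsOfFinAddOrder (τm (Ph - k₀ • g) - (-W.rootNumber) • (Ph - k₀ • g)) :=
    hsub (τm.isOfFinAddOrder hk₀) hk₀.zsmul
  have hk : IsOfFinAddOrder (k₀ • (τm g - (-W.rootNumber) • g)) := by
    have heq : k₀ • (τm g - (-W.rootNumber) • g) =
        (τm Ph - (-W.rootNumber) • Ph) - (τm (Ph - k₀ • g) - (-W.rootNumber) • (Ph - k₀ • g)) := by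
      rw [map_sub, map_zsmul]
      module
    rw [heq]
    exact hsub hgross ht₀
  have hg : IsOfFinAddOrder (τm g - (-W.rootNumber) • g) := by
    obtain ⟨n, hn0, hn⟩ := (isOfFinAddOrder_iff_zsmul_eq_zero).mp hk
    rw [smul_smul] at hn
    exact (isOfFinAddOrder_iff_zsmul_eq_zero).mpr ⟨n * k₀, mul_ne_zero hn0 hk₀ne, hn⟩
  -- `x = c g + t`
  obtain ⟨c, hc⟩ := hgT x
  have heq : τm x - (-W.rootNumber) • x =
      c • (τm g - (-W.rootNumber) • g) + (τm (x - c • g) - (-W.rootNumber) • (x - c • g)) := by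
    rw [map_sub, map_zsmul]
    module
  rw [heq]
  exact hg.zsmul.add (hsub (τm.isOfFinAddOrder hc) hc.zsmul)

end Summit.BirchSwinnertonDyer.BirchSwinnertonDyer.Theorems.CMKolyvaginFirstDescentTwo

end
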